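import Summits.QuantumFields.YangMills.Theorems.BalabanUVNodesK3Stub1OfScaleShift
import Summits.QuantumFields.YangMills.Theorems.BalabanUVNodesN17HolderGlueCoPH
import Summits.QuantumFields.YangMills.Theorems.BalabanUVNodesN17AtRecord13
import Summits.QuantumFields.YangMills.Theorems.BalabanUVNodesRateCarriersOfRecord13CoPH

/-!
# BalabanUVNodes ∕ node N17 = NE4 — THE SHARED N17 STUB OF K2⁷ v3 (`stub_n17AtRecord13 : N17AtRecord13`) AND K3⁷ v2 (the N17 conjunct of
# `stub_rates13H`'s rates predicate `PHolderD4`) AT THE ⁷ RECORD: READ, ROADS, JUNCTION, DELIVERY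

Cell `pub-ymgap` (HUMAN RULINGS D-0062 ∕ D-0149), WIDTH SEAT `pub-ymgap-dag-n17-w1` (seat 1 of 3 on NODE n17), generation 2; W-SEAT-START-LIST v7 (plan g80) §0
«NEW in v6: an NE4∕N17-at-the-record proof (n17∕n18 lanes) serves TWO registered stubs» + §2 n17 (item 1 RE-WORDED to K3⁷ v2).  THEOREMS ONLY (0 `def`,
0 `sorry`); filed `--kind proof --supports stmt-QuantumFields-20544 --as helper` (K3⁷ `SpineGivenEndpointR13SepCoPH`); the K2⁷ item served by name is
stmt-QuantumFields-20543 `EndpointGivenBR13SepCoPH`.  NO Theses ∕ skeleton import: the registered texts are SPELLED and were delta-tested in a scratch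
against the skeletons of record (K2⁷ v3 `D80-K2V3/K2Skeleton13SepCoPHv3.lean`; K3⁷ v3 `D81-K3V3/K3Skeleton13SepCoPHv3.lean` 02f6f498332fdbee, whose `PHolderD4 ∕
KeyedRatesHolderD4 ∕ rrOfRecord` are v2's 145a664ea9c38a7b verbatim — v3 adds the letter reading `ℓ` and the pin `U3PinnedKernels 𝔯 ℓ` to `GuardedReading`).

THE OBJECT.  K2⁷ v3's registered stub `stub_n17AtRecord13 : N17AtRecord13` reads, at `N = 2`,
`∀ F θ (hP : θ.Provisos₁₃SepCoPH F 2), θ.Admissible F 2 → ∃ u : U3Carriers, u.γ = θ.γ ∧ 0 ≤ u.ρ ∧ u.ρ < 1 ∧ N17At (datumOfRecord₁₃SepCoPH F 2 θ hP) u`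
(director-ym CRIT-2 C2's text; consumed by K2⁷ line 2's kernel junction `d4ShiftRate13_of_n17_anchor` and `EndpointGivenBR13SepCoPH_proof₂`).  K3⁷ v2 displays
the same two letters in its rates predicate `PHolderD4 β D R := RatesHolderAt D R β ∧ ReadOutAt D R.u3 ∧ (0 ≤ R.u3.ρ ∧ R.u3.ρ < 1)` (A3-ii) «so that ONE
NE4-at-the-record proof serves both» (v2 and v3 alike).  Below, «the BODY» means that sentence, stated for general `N` (it is the `N = 2` text literally at `N := 2`).

WHAT THIS FILE PROVES (kernel bookkeeping over tree declarations BY NAME; every node estimate stays a displayed hypothesis).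
* §1 READ.  `n17At_datumOfRecord₁₃SepCoPH_iff` (`Iff.rfl`: `N17At` at the ⁷ datum IS `ScaleShiftRate (u.cr·u.C₅·u.θ) u.ρ u.γ (betaOfRecord₁₃ F N θ.toStage13Params)`);
  `const_nonneg_of_n17At_datumOfRecord₁₃SepCoPH` (at an admissible tuple with `u.γ = θ.γ` the dependent constant is `≥ 0` — `NE4.scaleShiftRate_const_nonneg` +
  `Stage9Params.Admissible.gamma_pos`); ★ `n17AtRecord13Body_iff_scaleShift` — THE BODY ⟺ «∀ admissible ⁷ tuple, ∃ c ρ, 0 ≤ c ∧ 0 ≤ ρ ∧ ρ < 1 ∧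
  `ScaleShiftRate c ρ θ.γ (betaOfRecord₁₃ F N θ.toStage13Params)`» = seat g0's «N17 with free letters at the ⁷ record» (`…K3Stub1OfScaleShift` §1, the v1 image)
  SHARPENED BY EXACTLY THE DISPLAYED RATE LETTER `ρ < 1` (the (←) witness is companion 17's letter-degenerate node-U3 bundle, DISPLAYED as such: the junction letters
  pin `γ` and `ρ`, nothing pins `cr, C₅, θ` beyond their product); `n17AtRecord13Body_iff_merged` (the same in the canonical-version merged-β currency `βmTχ`, def-T's
  `βfun_datumOfRecord₁₃SepCoPH_eq_betaOfRecord₈Tχ`); `stub_rates13_of_n17AtRecord13Body` (at `N = 2` the BODY implies the RETIRED K3⁷ v1 stub 1 literally — g0 §3).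
* §2 ROADS INTO THE BODY (hypothesis form).  `n17AtRecord13Body_of_readOut_n18` — the BODY ⇐ the same sentence with `N17At` REPLACED by the guard-free node-U3 pair
  «(D4) `ReadOutAt` ∧ N18 `N18At`» (dag-n17-a `YMDAG.N17.n17At_of_readOutAt`; N22 idle for N17 proper) — the K2⁷-side producers' road, NO unity ∕ slot guard;
  `n17AtRecord13Body_of_rates` — the split road «(AF-0r)(β⁰ of record at rate ρ) ∧ remainder shift rate» (dag-n17-c `N17_of_rates_of_βfun_eq_betaOfRecord₈Tχ`).
* §3 JUNCTION WITH K3⁷ v2 STUB 1.  `exists_u3_n17At_of_pHolderD4` (pointwise, N-generic: `PHolderD4 β D R` SPELLED ⟹ `∃ u, u.γ = R.u3.γ ∧ 0 ≤ u.ρ ∧ u.ρ < 1 ∧ N17At D u`,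
  witness `R.u3`); ★ `n17AtRecord13Guarded_of_keyedRatesHolderD4` (`KeyedRatesHolderD4 β rr` SPELLED at the CoPH keys under ANY tuple guard `Rg`, plus the γ-face
  `(rr …).u3.γ = θ.γ` ⟹ THE BODY RESTRICTED TO `Rg`-TUPLES, along `Provisos₁₃SepCoPH.toCore` and def-T's `rfl` bridge `datumOfRecord₁₃SepCoPH_eq_coPH`);
  `n17AtRecord13Guarded_of_keyedRatesHolderD4_ofRecord` (at dag-n22-e's reading of record `rateCarriersOfRecord₁₃CoPH 𝔯 … (ksel …)` = the skeleton's `rrOfRecord 𝔯 ksel`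
  the γ-face is `rfl`); `n17AtRecord13Guarded_of_stub_rates13H_shape` (from the WHOLE v3 stub-1 shape `∃ β ∈ ]2∕3,1[, ∃ 𝔯 ksel ℓ, G 𝔯 ksel ℓ ∧ KeyedRatesHolderD4 …`,
  guard-and-pin `G` and the letter-reading type arbitrary).  HONEST, said once: K3⁷'s stub 1 serves K2⁷'s `stub_n17AtRecord13` ONLY ON THE GUARDED TUPLES `θ.ZhUnity F 2 ∧ θ.SlotsNondegenerate₁₃ F 2`; the
  guard-free remainder of K2⁷'s stub is K2⁷'s own (a guard-free NE4 proof serves both filings, a guard-using one serves K3⁷ only — the skeleton's (A3-ii) note, now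
  with its kernel half).
* §4 DELIVERY — the kernel reason CRIT-2 ∕ (A3-ii) display `ρ < 1`.  ★ `af0r_of_n17AtRecord13Body`: THE BODY ⟹ at every admissible ⁷ tuple, GIVEN def-B's named
  one-sided limit `Beta0LimitExists βmTχ θ.v₀` at a coherent admissible reference history (displayed, never asserted), (AF-0r) for the record's one-loop numbers
  `∃ c ≥ 0, ρ ∈ [0,1[, β⁰_∞, ∀ k, |beta0OfMerged βmTχ θ.v₀ k − β⁰_∞| ≤ (c∕(1−ρ))·ρ^k` (dag-n17-a `af0r_beta0OfMerged_of_scaleShiftRate`) — the `hconv` input of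
  NODE O ∕ K2⁷'s consumers; with `ρ = 1` allowed (K3⁷ v1) nothing of the kind follows.
* §5 HONESTY.  `n17AtRecord13Body_of_no_tuple`: with NO admissible ⁷ tuple at `N` (¬ K0⁷-shape) the BODY holds with no estimate — it is worth exactly K0⁷.
* §6 CLOSERS.  `n17AtRecord13Body_of_scaleShift` (sign-free) · `…_of_scaleShift_merged` (βmTχ) · ★ `n17AtRecord13Body_of_kernelStepRate` — THE BODY END TO END IN KERNEL
  CURRENCY: (UD) decay ∧ the history-matched step rate (rate `ρ < 1`) of the record's OWN limiting polarisation kernels `polLimit F (k+1) (mergedTermFamilyMatT … k v ·) θ.ρ8 θ.bV`.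

HONEST FRAMING.  Count-neutral helper lane; characterisations (`iff`) and by-name junctions of REGISTERED stubs; `stub_n17AtRecord13` ∕ `stub_rates13H` NOT
proved; NE4 = the scale-shift rate of Bałaban's FULL β-functions is NOT IN PRINT ([Balaban1987RG1] p. 264 «We will investigate other properties in a separate
paper») and NOT PROVED — at the record it is ONE sentence about `betaOfRecord₁₃` (second moments of the limiting polarisation kernels of the canonical-version
merged term family), neither closable nor refutable from tree facts; N17 NOT discharged (DEPENDENT ∕ DERIVED row); K2⁷ ∕ K3⁷ OPEN, NOT claimed; counts unmoved
(typed 28∕28 · discharged 5∕27, A 5∕28); one finite 𝕋⁴ programme at fixed ε — the YM mass gap (Clay) is NOT proved by any of this; R4 closes the conditional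
finite-𝕋⁴ rung `BalabanLadder.UV` only; nothing continuum ∕ ℝ⁴ ∕ OS.
-/

noncomputable section
open scoped Matrix.Norms.L2Operator

namespace Summit.QuantumFields.YangMills.Theorems.BalabanUVNodesN17AtRecord13SharedStub

open Literature.MathematicalPhysics.QuantumFieldTheory.Balaban1983to89
open Literature.MathematicalPhysics.QuantumFieldTheory.Balaban1983to89.FlowStep
open Literature.MathematicalPhysics.QuantumFieldTheory.Balaban1983to89.T4CouplingMatching (ScaleShiftRate)
open Literature.MathematicalPhysics.QuantumFieldTheory.Balaban1983to89.T4Continuum (T4Family ULoop)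
open Literature.MathematicalPhysics.QuantumFieldTheory.Balaban1983to89.Node00
open Summit.QuantumFields.BalabanUV.T4Continuum.Spine.NE4 (NE4OnData scaleShiftRate_const_nonneg)
open YMDAG.UVSplit (Datum U3Carriers RateCarriers N17At N18At ReadOutAt RateReading₁₃CoPH rateCarriersOfRecord₁₃CoPH)
open Summit.QuantumFields.YangMills.BalabanUVNodes.SpineRatesHolder (RatesHolderAt)
open Summit.QuantumFields.YangMills.Theorems.BalabanUVNodesK3Stub1OfScaleShift (stub_rates13_of_scaleShift)
open Summit.QuantumFields.YangMills.Theorems.BalabanUVNodesN17 (N17_iff_merged_of_βfun_eq_betaOfRecord₈Tχ N17_of_rates_of_βfun_eq_betaOfRecord₈Tχ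
  af0r_beta0OfMerged_of_scaleShiftRate)

variable {N : ℕ} [NeZero N]

/-! ## §1 READ — the body of the shared stub is «N17 with free constant and a rate in `[0, 1[` at the ⁷ record» -/

section Read

variable {F : T4Family}

/-- **N17 AT THE ⁷ DATUM IS THE SCALE-SHIFT RATE OF def-T's `betaOfRecord₁₃`** at the carriers' dependent letters `(u.cr·u.C₅·u.θ, u.ρ, u.γ)` (`Iff.rfl` through
`YMDAG.UVSplit.N17At`, `Spine.NE4.NE4OnData` and `Node00.βfun_datumOfRecord₁₃SepCoPH`). [cite: Balaban1987RG1, (1.20)-(1.22) p.264] -/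
theorem n17At_datumOfRecord₁₃SepCoPH_iff (θ : Stage13HParams F N) (hP : θ.Provisos₁₃SepCoPH F N) (u : U3Carriers) :
    N17At (datumOfRecord₁₃SepCoPH F N θ hP) u ↔ ScaleShiftRate (u.cr * u.C₅ * u.θ) u.ρ u.γ (betaOfRecord₁₃ F N θ.toStage13Params) :=
  Iff.rfl

/-- **AT AN ADMISSIBLE ⁷ TUPLE, ON THE RECORD's OWN WINDOW, N17 FORCES ITS DEPENDENT CONSTANT TO BE `≥ 0`**: the box `]0,θ.γ]²` is inhabited (`0 < θ.γ`,
`Stage9Params.Admissible.gamma_pos` through the parent views), so the `k = 0` instance of the shift inequality bounds `0 ≤ |…| ≤ c` (`NE4.scaleShiftRate_const_nonneg`).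
[folklore] -/
theorem const_nonneg_of_n17At_datumOfRecord₁₃SepCoPH (θ : Stage13HParams F N) (hP : θ.Provisos₁₃SepCoPH F N) (hθ : θ.Admissible F N) {u : U3Carriers}
    (hγ : u.γ = θ.γ) (h : N17At (datumOfRecord₁₃SepCoPH F N θ hP) u) : 0 ≤ u.cr * u.C₅ * u.θ := by
  have hpos : 0 < u.γ := by
    rw [hγ]
    exact hθ.toStage12.toStage9.gamma_pos
  exact scaleShiftRate_const_nonneg ((n17At_datumOfRecord₁₃SepCoPH_iff θ hP u).mp h) hpos

/-- ★ **THE BODY OF THE SHARED STUB, READ EXACTLY** (kernel `iff`, general `N`; at `N := 2` the left-hand side is K2⁷ v3's `N17AtRecord13` by delta): at every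
admissible ⁷ tuple SOME node-U3 bundle with window radius `θ.γ` and rate letter in `[0,1[` satisfies N17 on the datum of record — IFF — at every admissible ⁷ tuple
def-T's `betaOfRecord₁₃` has SOME scale-shift bound `|β_{k+2}(w) − β_{k+1}(tail w)| ≤ c·ρ^k` on `]0,θ.γ]^{k+2}` with `0 ≤ c` and `0 ≤ ρ < 1`.  (→) project the letters
`c := u.cr·u.C₅·u.θ` (its sign by `const_nonneg_of_n17At_datumOfRecord₁₃SepCoPH`), `ρ := u.ρ`; (←) the LETTER-DEGENERATE node-U3 bundle of companion 17's
`ratesAt_degenerate_iff` (one-point carriers, `W = ∅`, `θ = C₅ = 1`, `cr := c`, window `θ.γ`, rate `ρ`) — DISPLAYED AS SUCH: the two junction letters pin `γ` and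
`ρ`, nothing else of `u` is read by `N17At`.  = seat g0's «N17-free» sentence (`…K3Stub1OfScaleShift` §1) sharpened by `ρ < 1`. [bookkeeping] -/
theorem n17AtRecord13Body_iff_scaleShift :
    (∀ (F : T4Family) (θ : Stage13HParams F N) (hP : θ.Provisos₁₃SepCoPH F N), θ.Admissible F N →
        ∃ u : U3Carriers, u.γ = θ.γ ∧ 0 ≤ u.ρ ∧ u.ρ < 1 ∧ N17At (datumOfRecord₁₃SepCoPH F N θ hP) u) ↔
      ∀ (F : T4Family) (θ : Stage13HParams F N) (hP : θ.Provisos₁₃SepCoPH F N), θ.Admissible F N →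
        ∃ c ρ : ℝ, 0 ≤ c ∧ 0 ≤ ρ ∧ ρ < 1 ∧ ScaleShiftRate c ρ θ.γ (betaOfRecord₁₃ F N θ.toStage13Params) := by
  refine forall₄_congr fun F θ hP hθ => ⟨?_, ?_⟩
  · rintro ⟨u, hγ, hρ0, hρ1, h⟩
    refine ⟨u.cr * u.C₅ * u.θ, u.ρ, const_nonneg_of_n17At_datumOfRecord₁₃SepCoPH θ hP hθ hγ h, hρ0, hρ1, ?_⟩
    rw [← hγ]
    exact (n17At_datumOfRecord₁₃SepCoPH_iff θ hP u).mp h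
  · rintro ⟨c, ρ, -, hρ0, hρ1, h⟩
    refine ⟨{ C := { Dom := Unit, scale := fun _ => 0, d := fun _ => 0, d_nonneg := fun _ => le_rfl, BgA := Unit, BgB := Unit,
                      gauge := fun _ _ => 0, gauge_nonneg := fun _ _ => le_rfl, transport := fun x => x },
               W := ∅, γ := θ.γ, κ := 0, EA := fun _ _ _ => 0, EB := fun _ _ _ _ => 0, θ := 1, C₅ := 1, Λ := fun _ _ => 0, C₉ := 0, ω := 0,
               cr := c, ρ := ρ }, rfl, hρ0, hρ1, ?_⟩
    show ScaleShiftRate (c * 1 * 1) ρ θ.γ (betaOfRecord₁₃ F N θ.toStage13Params)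
    simpa only [mul_one] using h

/-- **THE BODY IN THE CANONICAL-VERSION MERGED-β CURRENCY** `βmTχ(θ) := betaMerged F (mergedTermFamilyMatT F N (TcanOfRecord F N) (chiFixed29 F N θ.ν θ.ε₂₉) θ.εbg) θ.ρ8 θ.bV`
(the box convention of `Node00.betaOfMerged` is invisible on the record's own window — dag-n17-c `N17_iff_merged_of_βfun_eq_betaOfRecord₈Tχ` at def-T's
`βfun_datumOfRecord₁₃SepCoPH_eq_betaOfRecord₈Tχ`, box side `θ.γ ≤ θ.γ`). [cite: Balaban1987RG1, (1.20)-(1.22) p.264] -/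
theorem n17AtRecord13Body_iff_merged :
    (∀ (F : T4Family) (θ : Stage13HParams F N) (hP : θ.Provisos₁₃SepCoPH F N), θ.Admissible F N →
        ∃ u : U3Carriers, u.γ = θ.γ ∧ 0 ≤ u.ρ ∧ u.ρ < 1 ∧ N17At (datumOfRecord₁₃SepCoPH F N θ hP) u) ↔
      ∀ (F : T4Family) (θ : Stage13HParams F N) (hP : θ.Provisos₁₃SepCoPH F N), θ.Admissible F N →
        letI := θ.instVβ₁; letI := θ.instVβ₂; letI := θ.instιβ
        ∃ c ρ : ℝ, 0 ≤ c ∧ 0 ≤ ρ ∧ ρ < 1 ∧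
          ScaleShiftRate c ρ θ.γ (betaMerged F (mergedTermFamilyMatT F N (TcanOfRecord F N) (chiFixed29 F N θ.ν θ.ε₂₉) θ.εbg) θ.ρ8 θ.bV) := by
  rw [n17AtRecord13Body_iff_scaleShift]
  refine forall₄_congr fun F θ hP hθ => ?_
  letI := θ.instVβ₁; letI := θ.instVβ₂; letI := θ.instιβ
  refine exists₂_congr fun c ρ => ?_
  have key : NE4OnData (datumOfRecord₁₃SepCoPH F N θ hP) c ρ θ.γ ↔
      ScaleShiftRate c ρ θ.γ (betaMerged F (mergedTermFamilyMatT F N (TcanOfRecord F N) (chiFixed29 F N θ.ν θ.ε₂₉) θ.εbg) θ.ρ8 θ.bV) :=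
    N17_iff_merged_of_βfun_eq_betaOfRecord₈Tχ (βfun_datumOfRecord₁₃SepCoPH_eq_betaOfRecord₈Tχ F N θ hP) le_rfl
  rw [← key]
  exact Iff.rfl

/-- **AT `N = 2` THE BODY IMPLIES THE RETIRED K3⁷ v1 STUB 1 LITERALLY** (seat g0's `stub_rates13_of_scaleShift`: v1's `∃ rr, KeyedRates rr ∧ KeyedWindow rr` needs only the
free form; the rate letter `ρ < 1` and the sign are dropped on the way) — recorded so that the v1 ∕ v2 ∕ K2⁷ readings of N17 at the ⁷ record sit in one kernel chain.
[bookkeeping] -/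
theorem stub_rates13_of_n17AtRecord13Body
    (h : ∀ (F : T4Family) (θ : Stage13HParams F 2) (hP : θ.Provisos₁₃SepCoPH F 2), θ.Admissible F 2 →
      ∃ u : U3Carriers, u.γ = θ.γ ∧ 0 ≤ u.ρ ∧ u.ρ < 1 ∧ N17At (datumOfRecord₁₃SepCoPH F 2 θ hP) u) :
    ∃ rr : (F : T4Family) → (θ : Stage13HParams F 2) → θ.Provisos₁₃SepCoPH F 2 → (ℕ → ℝ) → List (ULoop F) → RateCarriers 2,
      (∀ (F : T4Family) (θ : Stage13HParams F 2) (hP : θ.Provisos₁₃SepCoPH F 2), θ.Admissible F 2 → ∀ (g₀ : ℕ → ℝ) (os : List (ULoop F)),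
          YMDAG.UVSplit.RatesAt (datumOfRecord₁₃SepCoPH F 2 θ hP) (rr F θ hP g₀ os)) ∧
        ∀ (F : T4Family) (θ : Stage13HParams F 2) (hP : θ.Provisos₁₃SepCoPH F 2) (g₀ : ℕ → ℝ) (os : List (ULoop F)), (rr F θ hP g₀ os).u3.γ = θ.γ :=
  stub_rates13_of_scaleShift fun F θ hP hθ => by
    obtain ⟨c, ρ, -, -, -, hc⟩ := n17AtRecord13Body_iff_scaleShift.mp h F θ hP hθ
    exact ⟨c, ρ, hc⟩

end Read

/-! ## §2 ROADS INTO THE BODY (hypothesis form; the K2⁷-side producers' currency, no unity ∕ slot guard) -/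

section Roads

/-- ★ **THE BODY FROM THE GUARD-FREE NODE-U3 PAIR (D4) ∧ N18 AT THE ⁷ RECORD**: if at every admissible ⁷ tuple SOME node-U3 bundle with window radius `θ.γ` and
rate letter in `[0,1[` carries the β-read-out binders `ReadOutAt` on the datum of record AND N18 = NE5 for every member of run B's first-coupling family, then
the BODY holds with THE SAME bundle (dag-n17-a `YMDAG.N17.n17At_of_readOutAt`: the window clause, `RepresentsA∕B`, slice memberships, transport covariance and
the signs of `ReadOutAt` + NE5 ⟹ NE4; N22 idle for N17 proper).  This is the road on which «N17 DERIVED» is true for K2⁷ as well — at guard-free ⁷ tuples.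
(D4) ∕ NE5 UNPRINTED for d = 4 — binders. [cite: Balaban1987RG1, (1.20)-(1.22) p.264] -/
theorem n17AtRecord13Body_of_readOut_n18
    (h : ∀ (F : T4Family) (θ : Stage13HParams F N) (hP : θ.Provisos₁₃SepCoPH F N), θ.Admissible F N →
      ∃ u : U3Carriers, u.γ = θ.γ ∧ 0 ≤ u.ρ ∧ u.ρ < 1 ∧ ReadOutAt (datumOfRecord₁₃SepCoPH F N θ hP) u ∧ N18At u) :
    ∀ (F : T4Family) (θ : Stage13HParams F N) (hP : θ.Provisos₁₃SepCoPH F N), θ.Admissible F N →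
      ∃ u : U3Carriers, u.γ = θ.γ ∧ 0 ≤ u.ρ ∧ u.ρ < 1 ∧ N17At (datumOfRecord₁₃SepCoPH F N θ hP) u := by
  intro F θ hP hθ
  obtain ⟨u, hγ, hρ0, hρ1, hD4, h18⟩ := h F θ hP hθ
  exact ⟨u, hγ, hρ0, hρ1, YMDAG.N17.n17At_of_readOutAt _ hD4 h18⟩

/-- The same road with the bundle GIVEN as a keyed assignment `uu` (the shape a producer seat lands: one bundle per ⁷ tuple, its four faces as separate sentences).
[bookkeeping] -/
theorem n17AtRecord13Body_of_readOut_n18_keyed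
    (uu : (F : T4Family) → (θ : Stage13HParams F N) → θ.Provisos₁₃SepCoPH F N → U3Carriers)
    (hγ : ∀ (F : T4Family) (θ : Stage13HParams F N) (hP : θ.Provisos₁₃SepCoPH F N), θ.Admissible F N → (uu F θ hP).γ = θ.γ)
    (hρ : ∀ (F : T4Family) (θ : Stage13HParams F N) (hP : θ.Provisos₁₃SepCoPH F N), θ.Admissible F N → 0 ≤ (uu F θ hP).ρ ∧ (uu F θ hP).ρ < 1)
    (hD4 : ∀ (F : T4Family) (θ : Stage13HParams F N) (hP : θ.Provisos₁₃SepCoPH F N), θ.Admissible F N →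
      ReadOutAt (datumOfRecord₁₃SepCoPH F N θ hP) (uu F θ hP))
    (h18 : ∀ (F : T4Family) (θ : Stage13HParams F N) (hP : θ.Provisos₁₃SepCoPH F N), θ.Admissible F N → N18At (uu F θ hP)) :
    ∀ (F : T4Family) (θ : Stage13HParams F N) (hP : θ.Provisos₁₃SepCoPH F N), θ.Admissible F N →
      ∃ u : U3Carriers, u.γ = θ.γ ∧ 0 ≤ u.ρ ∧ u.ρ < 1 ∧ N17At (datumOfRecord₁₃SepCoPH F N θ hP) u :=
  n17AtRecord13Body_of_readOut_n18 fun F θ hP hθ =>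
    ⟨uu F θ hP, hγ F θ hP hθ, (hρ F θ hP hθ).1, (hρ F θ hP hθ).2, hD4 F θ hP hθ, h18 F θ hP hθ⟩

/-- **THE SPLIT ROAD INTO THE BODY** («β⁰ conv + β¹ shift» in the merged currency, dag-n17-c `N17_of_rates_of_βfun_eq_betaOfRecord₈Tχ` at def-T's ⁷ β-face): at every
admissible ⁷ tuple, a rate `ρ ∈ [0,1[`, constants `c₀ ≥ 0`, `c₁ ≥ 0` with (AF-0r) `|beta0OfMerged βmTχ θ.v₀ k − β⁰_∞| ≤ c₀ρ^k` (N15's currency) and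
`ScaleShiftRate c₁ ρ θ.γ (βmTχ − β⁰)` (N16 ∕ N18's) ⟹ the BODY with constant `2c₀ + c₁`.  Both binders UNPRINTED, displayed. [cite: Balaban1987RG1, (2.12)-(2.14) p.268] -/
theorem n17AtRecord13Body_of_rates
    (h : ∀ (F : T4Family) (θ : Stage13HParams F N) (hP : θ.Provisos₁₃SepCoPH F N), θ.Admissible F N →
      letI := θ.instVβ₁; letI := θ.instVβ₂; letI := θ.instιβ
      ∃ ρ c₀ c₁ binf : ℝ, 0 ≤ ρ ∧ ρ < 1 ∧ 0 ≤ c₀ ∧ 0 ≤ c₁ ∧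
        (∀ k, |beta0OfMerged (betaMerged F (mergedTermFamilyMatT F N (TcanOfRecord F N) (chiFixed29 F N θ.ν θ.ε₂₉) θ.εbg) θ.ρ8 θ.bV) θ.v₀ k - binf| ≤
          c₀ * ρ ^ k) ∧
        ScaleShiftRate c₁ ρ θ.γ fun k w =>
          betaMerged F (mergedTermFamilyMatT F N (TcanOfRecord F N) (chiFixed29 F N θ.ν θ.ε₂₉) θ.εbg) θ.ρ8 θ.bV k w -
            beta0OfMerged (betaMerged F (mergedTermFamilyMatT F N (TcanOfRecord F N) (chiFixed29 F N θ.ν θ.ε₂₉) θ.εbg) θ.ρ8 θ.bV) θ.v₀ k) :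
    ∀ (F : T4Family) (θ : Stage13HParams F N) (hP : θ.Provisos₁₃SepCoPH F N), θ.Admissible F N →
      ∃ u : U3Carriers, u.γ = θ.γ ∧ 0 ≤ u.ρ ∧ u.ρ < 1 ∧ N17At (datumOfRecord₁₃SepCoPH F N θ hP) u := by
  refine n17AtRecord13Body_iff_scaleShift.mpr fun F θ hP hθ => ?_
  letI := θ.instVβ₁; letI := θ.instVβ₂; letI := θ.instιβ
  obtain ⟨ρ, c₀, c₁, binf, hρ0, hρ1, hc₀, hc₁, hconv, hrem⟩ := h F θ hP hθ
  have key : NE4OnData (datumOfRecord₁₃SepCoPH F N θ hP) (2 * c₀ + c₁) ρ θ.γ :=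
    N17_of_rates_of_βfun_eq_betaOfRecord₈Tχ (βfun_datumOfRecord₁₃SepCoPH_eq_betaOfRecord₈Tχ F N θ hP) le_rfl hρ0 hρ1.le hc₀ hconv hrem
  exact ⟨2 * c₀ + c₁, ρ, by positivity, hρ0, hρ1, key⟩

end Roads

/-! ## §3 JUNCTION WITH K3⁷ v2 STUB 1 — its rates predicate `PHolderD4` SPELLED; K3⁷ serves the K2⁷ stub ON THE GUARDED TUPLES -/

section Junction

/-- **POINTWISE, N-GENERIC**: K3⁷ v2's rates-predicate body at `(D, R)` — `RatesHolderAt D R β ∧ ReadOutAt D R.u3 ∧ (0 ≤ R.u3.ρ ∧ R.u3.ρ < 1)` (= `PHolderD4 β D R`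
spelled) — gives the K2⁷ shape `∃ u, u.γ = R.u3.γ ∧ 0 ≤ u.ρ ∧ u.ρ < 1 ∧ N17At D u` with witness `u := R.u3` (N17 = the fourth conjunct of dag-n16-e's `RatesHolderAt`;
the (D4) conjunct is not even needed here).  The kernel half of the skeleton's (A3-ii) sentence. [bookkeeping] -/
theorem exists_u3_n17At_of_pHolderD4 {F : T4Family} (D : Datum F N) (R : RateCarriers N) (β : ℝ)
    (h : RatesHolderAt D R β ∧ ReadOutAt D R.u3 ∧ (0 ≤ R.u3.ρ ∧ R.u3.ρ < 1)) :
    ∃ u : U3Carriers, u.γ = R.u3.γ ∧ 0 ≤ u.ρ ∧ u.ρ < 1 ∧ N17At D u :=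
  ⟨R.u3, rfl, h.2.2.1, h.2.2.2, h.1.2.2.2.1⟩

/-- … and already from the DERIVED form (no N17 conjunct): `ReadOutAt D R.u3 ∧ N18At R.u3 ∧ (0 ≤ R.u3.ρ ∧ R.u3.ρ < 1)` ⟹ the same (dag-n17-a `YMDAG.N17.n17At_of_readOutAt`).
[bookkeeping] -/
theorem exists_u3_n17At_of_readOut_n18 {F : T4Family} (D : Datum F N) (R : RateCarriers N)
    (hD4 : ReadOutAt D R.u3) (h18 : N18At R.u3) (hρ : 0 ≤ R.u3.ρ ∧ R.u3.ρ < 1) :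
    ∃ u : U3Carriers, u.γ = R.u3.γ ∧ 0 ≤ u.ρ ∧ u.ρ < 1 ∧ N17At D u :=
  ⟨R.u3, rfl, hρ.1, hρ.2, YMDAG.N17.n17At_of_readOutAt D hD4 h18⟩

variable (Rg : (F : T4Family) → Stage13HParams F N → Prop)

/-- ★ **K3⁷ v2's `KeyedRatesHolderD4 β rr` (SPELLED at the CoPH keys, under ANY tuple guard `Rg` — the skeleton's is `θ.ZhUnity F 2 ∧ θ.SlotsNondegenerate₁₃ F 2`)
TOGETHER WITH THE γ-FACE `(rr F θ hP g₀ os).u3.γ = θ.γ` GIVES THE BODY OF K2⁷'s `N17AtRecord13` RESTRICTED TO THE `Rg`-TUPLES**: at a ⁷ tuple `(θ, hP)` pull the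
rates predicate back along `Provisos₁₃SepCoPH.toCore` (def-T; the datum of record is the same term, `datumOfRecord₁₃SepCoPH_eq_coPH` by `rfl`), read it at
`(g₀, os) := (0, [])`, and take `u := (rr F θ hP.toCore 0 []).u3`.  HONEST: off `Rg` nothing follows — K3⁷'s stub 1 serves K2⁷'s stub only on the guarded tuples.
[bookkeeping] -/
theorem n17AtRecord13Guarded_of_keyedRatesHolderD4 {β : ℝ}
    (rr : (F : T4Family) → (θ : Stage13HParams F N) → θ.Provisos₁₃CoPH F N → (ℕ → ℝ) → List (ULoop F) → RateCarriers N)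
    (hγ : ∀ (F : T4Family) (θ : Stage13HParams F N) (hP : θ.Provisos₁₃CoPH F N) (g₀ : ℕ → ℝ) (os : List (ULoop F)), (rr F θ hP g₀ os).u3.γ = θ.γ)
    (hr : ∀ (F : T4Family) (θ : Stage13HParams F N) (hP : θ.Provisos₁₃CoPH F N), Rg F θ → θ.Admissible F N →
      ∀ (g₀ : ℕ → ℝ) (os : List (ULoop F)),
        RatesHolderAt (datumOfRecord₁₃CoPH F N θ hP) (rr F θ hP g₀ os) β ∧ ReadOutAt (datumOfRecord₁₃CoPH F N θ hP) (rr F θ hP g₀ os).u3 ∧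
          (0 ≤ (rr F θ hP g₀ os).u3.ρ ∧ (rr F θ hP g₀ os).u3.ρ < 1)) :
    ∀ (F : T4Family) (θ : Stage13HParams F N) (hP : θ.Provisos₁₃SepCoPH F N), Rg F θ → θ.Admissible F N →
      ∃ u : U3Carriers, u.γ = θ.γ ∧ 0 ≤ u.ρ ∧ u.ρ < 1 ∧ N17At (datumOfRecord₁₃SepCoPH F N θ hP) u := by
  intro F θ hP hRg hθ
  obtain ⟨u, hu, hρ0, hρ1, h17⟩ := exists_u3_n17At_of_pHolderD4 _ _ β (hr F θ hP.toCore hRg hθ (fun _ => 0) [])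
  refine ⟨u, hu.trans (hγ F θ hP.toCore _ _), hρ0, hρ1, ?_⟩
  rw [datumOfRecord₁₃SepCoPH_eq_coPH]
  exact h17

/-- **… AT THE READING OF RECORD** `rr F θ hP g₀ os := rateCarriersOfRecord₁₃CoPH 𝔯 F θ hP g₀ os (ksel F θ hP g₀ os)` (dag-n22-e; = the skeleton's `rrOfRecord 𝔯 ksel`):
the γ-face is `rfl` (node U3's window radius IS `θ.γ`), so `KeyedRatesHolderD4 β (rrOfRecord 𝔯 ksel)` spelled ALONE gives the guarded body. [bookkeeping] -/
theorem n17AtRecord13Guarded_of_keyedRatesHolderD4_ofRecord {β : ℝ} (𝔯 : RateReading₁₃CoPH N)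
    (ksel : (F : T4Family) → (θ : Stage13HParams F N) → θ.Provisos₁₃CoPH F N → (ℕ → ℝ) → List (ULoop F) → ℕ)
    (hr : ∀ (F : T4Family) (θ : Stage13HParams F N) (hP : θ.Provisos₁₃CoPH F N), Rg F θ → θ.Admissible F N →
      ∀ (g₀ : ℕ → ℝ) (os : List (ULoop F)),
        RatesHolderAt (datumOfRecord₁₃CoPH F N θ hP) (rateCarriersOfRecord₁₃CoPH 𝔯 F θ hP g₀ os (ksel F θ hP g₀ os)) β ∧
          ReadOutAt (datumOfRecord₁₃CoPH F N θ hP) (rateCarriersOfRecord₁₃CoPH 𝔯 F θ hP g₀ os (ksel F θ hP g₀ os)).u3 ∧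
          (0 ≤ (rateCarriersOfRecord₁₃CoPH 𝔯 F θ hP g₀ os (ksel F θ hP g₀ os)).u3.ρ ∧
            (rateCarriersOfRecord₁₃CoPH 𝔯 F θ hP g₀ os (ksel F θ hP g₀ os)).u3.ρ < 1)) :
    ∀ (F : T4Family) (θ : Stage13HParams F N) (hP : θ.Provisos₁₃SepCoPH F N), Rg F θ → θ.Admissible F N →
      ∃ u : U3Carriers, u.γ = θ.γ ∧ 0 ≤ u.ρ ∧ u.ρ < 1 ∧ N17At (datumOfRecord₁₃SepCoPH F N θ hP) u :=
  n17AtRecord13Guarded_of_keyedRatesHolderD4 Rg (fun F θ hP g₀ os => rateCarriersOfRecord₁₃CoPH 𝔯 F θ hP g₀ os (ksel F θ hP g₀ os))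
    (fun _ _ _ _ _ => rfl) hr

/-- **… FROM THE WHOLE STUB-1 SHAPE OF K3⁷ v3** `∃ β, 2∕3 < β ∧ β < 1 ∧ ∃ 𝔯 ksel ℓ, G 𝔯 ksel ℓ ∧ KeyedRatesHolderD4 β (rrOfRecord 𝔯 ksel)` with the rates predicate
SPELLED, the guard-and-pin conjunct `G` (the skeleton's five-conjunct `GuardedReading 𝔯 ksel ℓ`) and the letter-reading type `Λ` (its `LetterReading`) ARBITRARY — N17 reads
none of them: the guarded body follows; `β`, `ℓ` and `G` are idle for it. [bookkeeping] -/
theorem n17AtRecord13Guarded_of_stub_rates13H_shape {Λ : Type*}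
    (G : RateReading₁₃CoPH N → ((F : T4Family) → (θ : Stage13HParams F N) → θ.Provisos₁₃CoPH F N → (ℕ → ℝ) → List (ULoop F) → ℕ) → Λ → Prop)
    (h : ∃ β : ℝ, 2 / 3 < β ∧ β < 1 ∧
      ∃ (𝔯 : RateReading₁₃CoPH N) (ksel : (F : T4Family) → (θ : Stage13HParams F N) → θ.Provisos₁₃CoPH F N → (ℕ → ℝ) → List (ULoop F) → ℕ) (l : Λ),
        G 𝔯 ksel l ∧
        ∀ (F : T4Family) (θ : Stage13HParams F N) (hP : θ.Provisos₁₃CoPH F N), Rg F θ → θ.Admissible F N →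
          ∀ (g₀ : ℕ → ℝ) (os : List (ULoop F)),
            RatesHolderAt (datumOfRecord₁₃CoPH F N θ hP) (rateCarriersOfRecord₁₃CoPH 𝔯 F θ hP g₀ os (ksel F θ hP g₀ os)) β ∧
              ReadOutAt (datumOfRecord₁₃CoPH F N θ hP) (rateCarriersOfRecord₁₃CoPH 𝔯 F θ hP g₀ os (ksel F θ hP g₀ os)).u3 ∧
              (0 ≤ (rateCarriersOfRecord₁₃CoPH 𝔯 F θ hP g₀ os (ksel F θ hP g₀ os)).u3.ρ ∧
                (rateCarriersOfRecord₁₃CoPH 𝔯 F θ hP g₀ os (ksel F θ hP g₀ os)).u3.ρ < 1)) :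
    ∀ (F : T4Family) (θ : Stage13HParams F N) (hP : θ.Provisos₁₃SepCoPH F N), Rg F θ → θ.Admissible F N →
      ∃ u : U3Carriers, u.γ = θ.γ ∧ 0 ≤ u.ρ ∧ u.ρ < 1 ∧ N17At (datumOfRecord₁₃SepCoPH F N θ hP) u := by
  obtain ⟨β, -, -, 𝔯, ksel, -, -, hr⟩ := h
  exact n17AtRecord13Guarded_of_keyedRatesHolderD4_ofRecord Rg 𝔯 ksel hr

end Junction

/-! ## §4 DELIVERY — with `ρ < 1` displayed, the body is an (AF-0r) PRODUCER for the record's one-loop numbers -/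

section Delivery

/-- ★ **WHAT THE SHARED STUB DELIVERS AT EVERY ADMISSIBLE ⁷ TUPLE: (AF-0r) FOR THE RECORD's ONE-LOOP NUMBERS.**  Given the BODY, at an admissible ⁷ tuple `(θ, hP)`
— and GIVEN def-B's named one-sided limit `Beta0LimitExists βmTχ θ.v₀` ([Balaban1987RG1] (2.13) «vanishes at g_k = 0», a displayed estimate, never asserted) at a
COHERENT reference history with entries in `]0,θ.γ]` — there are `c ≥ 0`, `ρ ∈ [0,1[` and `β⁰_∞` with `|beta0OfMerged βmTχ θ.v₀ k − β⁰_∞| ≤ (c∕(1−ρ))·ρ^k` for all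
`k` (dag-n17-a `af0r_beta0OfMerged_of_scaleShiftRate`: the shift inequality passes to the `g → 0⁺` limit, then sums geometrically BECAUSE `ρ < 1`).  This is the
`hconv` input of NODE O ∕ K2⁷ line 2's consumers; it is the kernel reason the junction letter `ρ < 1` is displayed in BOTH registered stubs (with `ρ = 1`, K3⁷ v1's
reading, no such bound follows). [cite: Balaban1987RG1, (2.12)-(2.14) p.268] -/
theorem af0r_of_n17AtRecord13Body
    (h : ∀ (F : T4Family) (θ : Stage13HParams F N) (hP : θ.Provisos₁₃SepCoPH F N), θ.Admissible F N →
      ∃ u : U3Carriers, u.γ = θ.γ ∧ 0 ≤ u.ρ ∧ u.ρ < 1 ∧ N17At (datumOfRecord₁₃SepCoPH F N θ hP) u)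
    (F : T4Family) (θ : Stage13HParams F N) (hP : θ.Provisos₁₃SepCoPH F N) (hθ : θ.Admissible F N)
    (hlim : letI := θ.instVβ₁; letI := θ.instVβ₂; letI := θ.instιβ
      Beta0LimitExists (betaMerged F (mergedTermFamilyMatT F N (TcanOfRecord F N) (chiFixed29 F N θ.ν θ.ε₂₉) θ.εbg) θ.ρ8 θ.bV) θ.v₀)
    (hcoh : ∀ k, Fin.tail (θ.v₀ (k + 1)) = θ.v₀ k) (hadm : ∀ k i, 0 < θ.v₀ k i ∧ θ.v₀ k i ≤ θ.γ) :
    letI := θ.instVβ₁; letI := θ.instVβ₂; letI := θ.instιβ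
    ∃ c ρ binf : ℝ, 0 ≤ c ∧ 0 ≤ ρ ∧ ρ < 1 ∧
      ∀ k, |beta0OfMerged (betaMerged F (mergedTermFamilyMatT F N (TcanOfRecord F N) (chiFixed29 F N θ.ν θ.ε₂₉) θ.εbg) θ.ρ8 θ.bV) θ.v₀ k - binf| ≤
        c / (1 - ρ) * ρ ^ k := by
  letI := θ.instVβ₁; letI := θ.instVβ₂; letI := θ.instιβ
  obtain ⟨c, ρ, hc, hρ0, hρ1, hS⟩ := n17AtRecord13Body_iff_merged.mp h F θ hP hθ
  obtain ⟨binf, hb⟩ := af0r_beta0OfMerged_of_scaleShiftRate hlim hcoh hadm hθ.toStage12.toStage9.gamma_pos hρ1 hS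
  exact ⟨c, ρ, binf, hc, hρ0, hρ1, hb⟩

end Delivery

/-! ## §5 HONESTY — without an admissible ⁷ tuple the body is vacuous (worth exactly K0⁷) -/

section Honesty

/-- **HYPOTHESIS FORM**: if NO ⁷ Stage-13 tuple with provisos is admissible at `N` on any family (the negation of K0⁷'s body with the guards dropped), the BODY holds
WITH NO ESTIMATE — the shared N17 stub is then worth exactly K0⁷ (cf. dag-n22-e `k4_rRec₁₃CoPH_of_uninhabited`). [bookkeeping] -/
theorem n17AtRecord13Body_of_no_tuple
    (hno : ∀ (F : T4Family) (θ : Stage13HParams F N), θ.Provisos₁₃SepCoPH F N → ¬ θ.Admissible F N) :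
    ∀ (F : T4Family) (θ : Stage13HParams F N) (hP : θ.Provisos₁₃SepCoPH F N), θ.Admissible F N →
      ∃ u : U3Carriers, u.γ = θ.γ ∧ 0 ≤ u.ρ ∧ u.ρ < 1 ∧ N17At (datumOfRecord₁₃SepCoPH F N θ hP) u :=
  fun F θ hP hθ => absurd hθ (hno F θ hP)

end Honesty

/-! ## §6 CLOSERS AND THE KERNEL-CURRENCY ROAD — what a prover of `stub_n17AtRecord13` must show about the record's OWN polarisation kernels -/

section Closers

open Literature.MathematicalPhysics.QuantumFieldTheory.Balaban1983to89.B12Sec2to5 (Decay510 betaPrime510)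
open Literature.MathematicalPhysics.QuantumFieldTheory.Balaban1983to89.Beta.LimitRate (subKernel)
open Summit.QuantumFields.YangMills.Theorems.BalabanUVNodesN17 (scaleShiftRate_betaMerged_of_kernelStepRate)

/-- **THE SIGN-FREE CLOSER**: at every admissible ⁷ tuple SOME scale-shift bound `ScaleShiftRate c ρ θ.γ (betaOfRecord₁₃ F N θ.toStage13Params)` with `0 ≤ ρ < 1` (no sign asked
of `c` — it is automatic, §1) ⟹ the BODY (the letter-degenerate node-U3 bundle of §1, displayed as such). [bookkeeping] -/
theorem n17AtRecord13Body_of_scaleShift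
    (h : ∀ (F : T4Family) (θ : Stage13HParams F N) (hP : θ.Provisos₁₃SepCoPH F N), θ.Admissible F N →
      ∃ c ρ : ℝ, 0 ≤ ρ ∧ ρ < 1 ∧ ScaleShiftRate c ρ θ.γ (betaOfRecord₁₃ F N θ.toStage13Params)) :
    ∀ (F : T4Family) (θ : Stage13HParams F N) (hP : θ.Provisos₁₃SepCoPH F N), θ.Admissible F N →
      ∃ u : U3Carriers, u.γ = θ.γ ∧ 0 ≤ u.ρ ∧ u.ρ < 1 ∧ N17At (datumOfRecord₁₃SepCoPH F N θ hP) u := by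
  refine n17AtRecord13Body_iff_scaleShift.mpr fun F θ hP hθ => ?_
  obtain ⟨c, ρ, hρ0, hρ1, hS⟩ := h F θ hP hθ
  exact ⟨c, ρ, scaleShiftRate_const_nonneg hS hθ.toStage12.toStage9.gamma_pos, hρ0, hρ1, hS⟩

/-- **THE SIGN-FREE CLOSER IN THE MERGED CURRENCY** `βmTχ(θ)` (box side `θ.γ`; dag-n17-c `N17_iff_merged_of_βfun_eq_betaOfRecord₈Tχ` at def-T's ⁷ β-face). [cite: Balaban1987RG1, (1.20)-(1.22) p.264] -/
theorem n17AtRecord13Body_of_scaleShift_merged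
    (h : ∀ (F : T4Family) (θ : Stage13HParams F N) (hP : θ.Provisos₁₃SepCoPH F N), θ.Admissible F N →
      letI := θ.instVβ₁; letI := θ.instVβ₂; letI := θ.instιβ
      ∃ c ρ : ℝ, 0 ≤ ρ ∧ ρ < 1 ∧
        ScaleShiftRate c ρ θ.γ (betaMerged F (mergedTermFamilyMatT F N (TcanOfRecord F N) (chiFixed29 F N θ.ν θ.ε₂₉) θ.εbg) θ.ρ8 θ.bV)) :
    ∀ (F : T4Family) (θ : Stage13HParams F N) (hP : θ.Provisos₁₃SepCoPH F N), θ.Admissible F N →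
      ∃ u : U3Carriers, u.γ = θ.γ ∧ 0 ≤ u.ρ ∧ u.ρ < 1 ∧ N17At (datumOfRecord₁₃SepCoPH F N θ hP) u := by
  refine n17AtRecord13Body_of_scaleShift fun F θ hP hθ => ?_
  letI := θ.instVβ₁; letI := θ.instVβ₂; letI := θ.instιβ
  obtain ⟨c, ρ, hρ0, hρ1, hS⟩ := h F θ hP hθ
  refine ⟨c, ρ, hρ0, hρ1, ?_⟩
  have key : NE4OnData (datumOfRecord₁₃SepCoPH F N θ hP) c ρ θ.γ :=
    (N17_iff_merged_of_βfun_eq_betaOfRecord₈Tχ (βfun_datumOfRecord₁₃SepCoPH_eq_betaOfRecord₈Tχ F N θ hP) le_rfl).mpr hS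
  exact key

/-- ★ **THE SHARED STUB END TO END IN KERNEL CURRENCY** (dag-n17-a `scaleShiftRate_betaMerged_of_kernelStepRate` at def-T's ⁷ β-face): the merged β of record IS, by `rfl`,
the second moment `Σ_x Π_{k+1,01}(v; x) x₀x₁` of the LIMITING POLARISATION KERNELS `Π_{k+1}(v; ·) := Node00.polLimit F (k+1) (ℰ k v ·) θ.ρ8 θ.bV` of the canonical-version merged
term family `ℰ := mergedTermFamilyMatT F N (TcanOfRecord F N) (chiFixed29 F N θ.ν θ.ε₂₉) θ.εbg` ((1.6) ∕ (1.20)–(1.22) typed by def-B ∕ def-T); so at every admissible ⁷ tuple,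
(UD) — the (5.10)-type decay `|Π_{k+1,01}(v; x)| ≤ C e^{−δ|x|₁}` on the boxes `]0,θ.γ]^{k+1}` (PRINTED for Bałaban's kernels, [I] (5.10) p. 293; a binder here) — AND THE
HISTORY-MATCHED KERNEL STEP RATE `|Π_{k+2,01}(w; x) − Π_{k+1,01}(tail w; x)| ≤ C′ρ^k e^{−δ′|x|₁}` on `]0,θ.γ]^{k+2}` with `0 ≤ ρ < 1` (NOT PRINTED — rows NE2 ∕ NE3 ∕ NE5
in the record's letters; King's (4.38) is the `A = 0` template) ⟹ THE BODY, with constant `β′(C′,δ′) = C′Σ_x|x|₁²e^{−δ′|x|₁}`.  This is the honest price of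
`stub_n17AtRecord13` ∕ of K3⁷'s N17 conjunct for a GENUINE prover: two statements about THE RECORD's OWN KERNELS, nothing else (no `Beta0LimitExists`, no one-loop
dictionary). [cite: Balaban1987RG1, (1.21)-(1.22) p.264 and (5.10) p.293] -/
theorem n17AtRecord13Body_of_kernelStepRate
    (h : ∀ (F : T4Family) (θ : Stage13HParams F N) (hP : θ.Provisos₁₃SepCoPH F N), θ.Admissible F N →
      letI := θ.instVβ₁; letI := θ.instVβ₂; letI := θ.instιβ
      ∃ C δ C' δ' ρ : ℝ, 0 < δ ∧ 0 < δ' ∧ 0 ≤ ρ ∧ ρ < 1 ∧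
        (∀ k (v : Fin (k + 1) → ℝ), v ∈ Box θ.γ k →
          Decay510 (polLimit F (k + 1)
            (fun K => mergedTermFamilyMatT F N (TcanOfRecord F N) (chiFixed29 F N θ.ν θ.ε₂₉) θ.εbg k v K) θ.ρ8 θ.bV 0 1) C δ) ∧
        (∀ k (w : Fin (k + 2) → ℝ), w ∈ Box θ.γ (k + 1) →
          Decay510 (subKernel
            (polLimit F (k + 1 + 1) (fun K => mergedTermFamilyMatT F N (TcanOfRecord F N) (chiFixed29 F N θ.ν θ.ε₂₉) θ.εbg (k + 1) w K) θ.ρ8 θ.bV)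
            (polLimit F (k + 1) (fun K => mergedTermFamilyMatT F N (TcanOfRecord F N) (chiFixed29 F N θ.ν θ.ε₂₉) θ.εbg k (Fin.tail w) K) θ.ρ8 θ.bV)
            0 1) (C' * ρ ^ k) δ')) :
    ∀ (F : T4Family) (θ : Stage13HParams F N) (hP : θ.Provisos₁₃SepCoPH F N), θ.Admissible F N →
      ∃ u : U3Carriers, u.γ = θ.γ ∧ 0 ≤ u.ρ ∧ u.ρ < 1 ∧ N17At (datumOfRecord₁₃SepCoPH F N θ hP) u := by
  refine n17AtRecord13Body_of_scaleShift_merged fun F θ hP hθ => ?_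
  letI := θ.instVβ₁; letI := θ.instVβ₂; letI := θ.instιβ
  obtain ⟨C, δ, C', δ', ρ, hδ, hδ', hρ0, hρ1, hU, hS⟩ := h F θ hP hθ
  exact ⟨betaPrime510 4 C' δ', ρ, hρ0, hρ1, scaleShiftRate_betaMerged_of_kernelStepRate F _ θ.ρ8 θ.bV hδ hδ' hU hS⟩

end Closers

end Summit.QuantumFields.YangMills.Theorems.BalabanUVNodesN17AtRecord13SharedStub

end
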